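import Literature.NumberTheory.LFunctions.WeilGroundState
import Mathlib.MeasureTheory.Function.ConvergenceInMeasure
import HarnessLib

/-!
# Crux `GroundBarta.PolarPerronFrobenius` (stmt-RiemannHypothesis-18390), line `Sketch`
# (cone–compactness): stub S4 `stub_aeNonneg_of_L2_limit` (RH-free, pure measure theory)

An `L²(ℝ)`-limit `u` of pointwise real, non-negative functions `gₙ` (`∫ ‖gₙ - u‖² → 0`) is a.e. real
and non-negative: `L²` convergence is convergence of `eLpNorm (gₙ - u) 2` to `0`
(`eLpNorm_two_eq_ofReal_sqrt`, in tree), hence convergence in measure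
(`tendstoInMeasure_of_tendsto_eLpNorm`), hence an a.e.-convergent subsequence
(`TendstoInMeasure.exists_seq_tendsto_ae`), and the cone `{z : ℂ | z.im = 0 ∧ 0 ≤ z.re}` is closed.
Mathlib + the tree's `WeilGroundState` (for the `eLpNorm` bookkeeping) only; no named fact.
-/

set_option linter.dupNamespace false

noncomputable section

open Set MeasureTheory Filter Complex
open scoped Topology

namespace Summit.RiemannHypothesis.RiemannHypothesis.Theorems.PolarPerronFrobenius

open Literature.NumberTheory.LFunctions

/-- **Stub S4 of line `Sketch` (cone–compactness) — the sign cone is closed under `L²` limits.**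
If `gₙ ∈ L²` are pointwise real and `≥ 0`, `u ∈ L²` and `∫ ‖gₙ - u‖² → 0`, then `u` is a.e. real
and `≥ 0` (convergence in measure, a.e.-convergent subsequence, closedness of the cone). -/
theorem stub_aeNonneg_of_L2_limit :
    ∀ (g : ℕ → ℝ → ℂ) (u : ℝ → ℂ), (∀ n, MeasureTheory.MemLp (g n) 2) → MeasureTheory.MemLp u 2 →
      (∀ n t, (g n t).im = 0 ∧ 0 ≤ (g n t).re) →
      Filter.Tendsto (fun n => ∫ t, ‖g n t - u t‖ ^ 2) Filter.atTop (nhds 0) →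
      ∀ᵐ t : ℝ, (u t).im = 0 ∧ 0 ≤ (u t).re := by
  intro g u hg hu hsign hlim
  -- `eLpNorm (gₙ - u) 2 → 0`
  have hmem : ∀ n, MemLp (g n - u) 2 := fun n => (hg n).sub hu
  have hnorm : ∀ n, eLpNorm (g n - u) 2 volume =
      ENNReal.ofReal (Real.sqrt (∫ t, ‖g n t - u t‖ ^ 2)) := fun n =>
    eLpNorm_two_eq_ofReal_sqrt (hmem n)
  have hten : Tendsto (fun n => eLpNorm (g n - u) 2 volume) atTop (𝓝 0) := by
    have h1 : Tendsto (fun n => ENNReal.ofReal (Real.sqrt (∫ t, ‖g n t - u t‖ ^ 2))) atTop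
        (𝓝 (ENNReal.ofReal (Real.sqrt 0))) :=
      (ENNReal.continuous_ofReal.tendsto _).comp
        ((Real.continuous_sqrt.tendsto _).comp hlim)
    rw [Real.sqrt_zero, ENNReal.ofReal_zero] at h1
    exact h1.congr fun n => (hnorm n).symm
  -- convergence in measure, an a.e.-convergent subsequence, closedness of the cone
  have hinm : TendstoInMeasure volume g atTop u :=
    tendstoInMeasure_of_tendsto_eLpNorm (by norm_num) (fun n => (hg n).1) hu.1 hten
  obtain ⟨ns, -, hae⟩ := hinm.exists_seq_tendsto_ae
  have hclosed : IsClosed {z : ℂ | z.im = 0 ∧ 0 ≤ z.re} :=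
    (isClosed_eq Complex.continuous_im continuous_const).inter
      (isClosed_le continuous_const Complex.continuous_re)
  filter_upwards [hae] with t ht
  exact hclosed.mem_of_tendsto ht (Eventually.of_forall fun i => hsign (ns i) t)

end Summit.RiemannHypothesis.RiemannHypothesis.Theorems.PolarPerronFrobenius

end
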